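import Summits.Langlands.Langlands.Theses.ParityBlindBianchi

/-!
BC3 birth skeleton — child `WeakExistenceIrreducible` of `ParityBlindBianchi.EvenArtinJunction` (stmt-Langlands-2908),
crux-strategist planner-cstrat-stmt-Langlands-2908-r1-0, 2026-08-17.  Exactly 2 named stubs (the ONLY sorries) and
`WeakExistenceIrreducible_of : stub₁ → stub₂ → WeakExistenceIrreducible` kernel-checked.  Context = the route file's (the child is restated from Sketch.lean;
after `route edit --split` installs the child decl, delete the `def` below and re-run `ledger skeleton check`).
Stubs: W₁ weak existence (BG 3.2.2, = 10368's W = 14328's stub W); W₂ irreducibility of avatars of cuspidal π (Ramakrishnan; isobaric bootstrap).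
-/

set_option linter.dupNamespace false

namespace Summit.Langlands.Langlands.Theses.ParityBlindBianchi

open scoped BigOperators Topology Manifold Classical MeasureTheory ProbabilityTheory Matrix InnerProductSpace ComplexConjugate ContinuousMap
open Filter Set Function TopologicalSpace MeasureTheory

/-- W_irr — weak existence with irreducibility. -/
def WeakExistenceIrreducible : Prop :=
  ∀ (K : Type) [Field K] [NumberField K] (n : ℕ) (hcpt : Literature.NumberTheory.Automorphic.isCompact_glFiniteIntegralLevel n K), 0 < n → ∀ π : Literature.NumberTheory.Automorphic.CuspidalAutomorphicRepData n K hcpt, π.1.IsLAlgebraic → ∀ (ℓ : ℕ) [Fact ℓ.Prime] (ι : PadicAlgCl ℓ ≃+* ℂ), ∃ ρ : Literature.NumberTheory.GaloisRepresentations.FramedGaloisRep K (PadicAlgCl ℓ) n, ρ.toGaloisRep.IsIrreducible ∧ ((∀ᶠ v : IsDedekindDomain.HeightOneSpectrum (NumberField.RingOfIntegers K) in cofinite, ρ.IsUnramifiedAt v) ∧ ∀ (v : IsDedekindDomain.HeightOneSpectrum (NumberField.RingOfIntegers K)) (hv : ((ℓ : ℕ) : NumberField.RingOfIntegers K) ∈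 v.asIdeal), (Literature.NumberTheory.PAdicHodge.fontainePstAdicCompletion v ℓ hv).IsDeRhamFramed (ρ.toLocal v)) ∧ ∀ᶠ v : IsDedekindDomain.HeightOneSpectrum (NumberField.RingOfIntegers K) in cofinite, SatakeFrobCompatibleAt ι π.1 ρ v

namespace Cruxes.WeakExistenceIrreducible.Birth

/-- **stub W₁ (OPEN: weak existence, Buzzard–Gee Conj. 3.2.2 weak form)** — every L-algebraic cuspidal `π` has a
pinned-geometric `ℓ`-adic avatar Satake–Frobenius compatible a.e. (no irreducibility).  VERBATIM the text `W` =
child `WeakExistence` filed for `CapacityClassicality.SectorToLanglands` (stmt-Langlands-10368) = the registered stub W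
of line `Sketch` on the shared crux stmt-Langlands-14328.  Known: regular algebraic `π` over totally real / CM `K`
(HLTT 2016, Scholze 2015; de Rham: A'Campo 2024) — open core: irregular `π`, general `K`.
[cite: BuzzardGeeLMS2014, Conj. 3.2.2] [cite: Scholze2015, Thm. 1.0.4] -/
theorem stub_weakExistence :
    ∀ (K : Type) [Field K] [NumberField K] (n : ℕ) (hcpt : Literature.NumberTheory.Automorphic.isCompact_glFiniteIntegralLevel n K), 0 < n → ∀ π : Literature.NumberTheory.Automorphic.CuspidalAutomorphicRepData n K hcpt, π.1.IsLAlgebraic → ∀ (ℓ : ℕ) [Fact ℓ.Prime] (ι : PadicAlgCl ℓ ≃+* ℂ), ∃ ρ : Literature.NumberTheory.GaloisRepresentations.FramedGaloisRep K (PadicAlgCl ℓ) n, ((∀ᶠ v : IsDedekindDomain.HeightOneSpectrum (NumberField.RingOfIntegers K) in cofinite, ρ.IsUnramifiedAt v) ∧ ∀ (v : IsDedekindDomain.HeightOneSpectrum (NumberField.RingOfIntegers K)) (hv : ((ℓ : ℕ) : NumberField.RingOfIntegers K) ∈ v.asIdeal), (Literature.NumberTheory.PAdicHodge.fontainePstAdicCompletion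 v ℓ hv).IsDeRhamFramed (ρ.toLocal v)) ∧ ∀ᶠ v : IsDedekindDomain.HeightOneSpectrum (NumberField.RingOfIntegers K) in cofinite, SatakeFrobCompatibleAt ι π.1 ρ v := by
  sorry

/-- **stub W₂ (OPEN: avatars of CUSPIDAL `π` are irreducible — Ramakrishnan's conjecture, in the transferable
form)** — every pinned-geometric `ρ` Satake–Frobenius compatible a.e. with an L-algebraic cuspidal `π` is
irreducible.  Landed modulo other leaves: the isobaric bootstrap `isIrreducible_of_reciprocityUpToIrreducibility`
(B_w + Arthur–Clozel (2.2)–(2.3) + reciprocity up to irreducibility; p103935) and the Chebotarev–Brauer–Nesbitt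
transfer; known outright for `n ≤ 3` regular over totally real fields (Ribet, Blasius–Rogawski) and in the CM
`GL₃` sector (route IrreducibilityBySelfDuality). [cite: CalegariGee2013, §1.1] [cite: DeligneSerreASENS1974, Lemme 3.2] -/
theorem stub_avatarIrreducible :
    ∀ (K : Type) [Field K] [NumberField K] (n : ℕ) (hcpt : Literature.NumberTheory.Automorphic.isCompact_glFiniteIntegralLevel n K), 0 < n → ∀ π : Literature.NumberTheory.Automorphic.CuspidalAutomorphicRepData n K hcpt, π.1.IsLAlgebraic → ∀ (ℓ : ℕ) [Fact ℓ.Prime] (ι : PadicAlgCl ℓ ≃+* ℂ) (ρ : Literature.NumberTheory.GaloisRepresentations.FramedGaloisRep K (PadicAlgCl ℓ) n), ((∀ᶠ v : IsDedekindDomain.HeightOneSpectrum (NumberField.RingOfIntegers K) in cofinite, ρ.IsUnramifiedAt v) ∧ ∀ (v : IsDedekindDomain.HeightOneSpectrum (NumberField.RingOfIntegers K)) (hv : ((ℓ : ℕ) : NumberField.RingOfIntegers K) ∈ v.asIdeal), (Literature.NumberTheory.PAdicHodge.fontainePstAdicCompletion v ℓ hv).IsDeRhamFramed (ρ.toLocal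 v)) → (∀ᶠ v : IsDedekindDomain.HeightOneSpectrum (NumberField.RingOfIntegers K) in cofinite, SatakeFrobCompatibleAt ι π.1 ρ v) → ρ.toGaloisRep.IsIrreducible := by
  sorry

/-- **W_irr from its two stubs**: the avatar of W₁ is irreducible by W₂. -/
theorem WeakExistenceIrreducible_of :
    (∀ (K : Type) [Field K] [NumberField K] (n : ℕ) (hcpt : Literature.NumberTheory.Automorphic.isCompact_glFiniteIntegralLevel n K), 0 < n → ∀ π : Literature.NumberTheory.Automorphic.CuspidalAutomorphicRepData n K hcpt, π.1.IsLAlgebraic → ∀ (ℓ : ℕ) [Fact ℓ.Prime] (ι : PadicAlgCl ℓ ≃+* ℂ), ∃ ρ : Literature.NumberTheory.GaloisRepresentations.FramedGaloisRep K (PadicAlgCl ℓ) n, ((∀ᶠ v : IsDedekindDomain.HeightOneSpectrum (NumberField.RingOfIntegers K) in cofinite, ρ.IsUnramifiedAt v) ∧ ∀ (v : IsDedekindDomain.HeightOneSpectrum (NumberField.RingOfIntegers K)) (hv : ((ℓ : ℕ) : NumberField.RingOfIntegers K) ∈ v.asIdeal), (Literature.NumberTheory.PAdicHodge.fontainePstAdicCompletion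 v ℓ hv).IsDeRhamFramed (ρ.toLocal v)) ∧ ∀ᶠ v : IsDedekindDomain.HeightOneSpectrum (NumberField.RingOfIntegers K) in cofinite, SatakeFrobCompatibleAt ι π.1 ρ v) →
    (∀ (K : Type) [Field K] [NumberField K] (n : ℕ) (hcpt : Literature.NumberTheory.Automorphic.isCompact_glFiniteIntegralLevel n K), 0 < n → ∀ π : Literature.NumberTheory.Automorphic.CuspidalAutomorphicRepData n K hcpt, π.1.IsLAlgebraic → ∀ (ℓ : ℕ) [Fact ℓ.Prime] (ι : PadicAlgCl ℓ ≃+* ℂ) (ρ : Literature.NumberTheory.GaloisRepresentations.FramedGaloisRep K (PadicAlgCl ℓ) n), ((∀ᶠ v : IsDedekindDomain.HeightOneSpectrum (NumberField.RingOfIntegers K) in cofinite, ρ.IsUnramifiedAt v) ∧ ∀ (v : IsDedekindDomain.HeightOneSpectrum (NumberField.RingOfIntegers K)) (hv : ((ℓ : ℕ) : NumberField.RingOfIntegers K) ∈ v.asIdeal), (Literature.NumberTheory.PAdicHodge.fontainePstAdicCompletion v ℓ hv).IsDeRhamFramed (ρ.toLocal v)) → (∀ᶠ v : IsDedekindDomain.HeightOneSpectrum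 (NumberField.RingOfIntegers K) in cofinite, SatakeFrobCompatibleAt ι π.1 ρ v) → ρ.toGaloisRep.IsIrreducible) →
    WeakExistenceIrreducible := by
  intro h1 h2 K _ _ n hcpt hn π hL ℓ _ ι
  obtain ⟨ρ, hgeo, hρ⟩ := h1 K n hcpt hn π hL ℓ ι
  exact ⟨ρ, h2 K n hcpt hn π hL ℓ ι ρ hgeo hρ, hgeo, hρ⟩

/-- The composition with the stubs plugged in: `WeakExistenceIrreducible` modulo exactly {W₁, W₂}. -/
theorem WeakExistenceIrreducible_of_stubs : WeakExistenceIrreducible :=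
  WeakExistenceIrreducible_of stub_weakExistence stub_avatarIrreducible

end Cruxes.WeakExistenceIrreducible.Birth

end Summit.Langlands.Langlands.Theses.ParityBlindBianchi
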